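import Summits.ABC.IUTFork.Repair.RHAxisCK2Requirements
import Summits.ABC.IUTFork.Repair.RHReqsideWeightLawsSignTierL1Datum
import HarnessLib

/-!
# R-H ROUND-3 AXIS C, item (b) TYPING LANE (ruling R79, KEY «C-TYPE-K1» clause (3)), k2 companion B: the per-datum ARITHMETIC SHADOW of a truncated-label
# theory in OUR cell currency, the label-symmetry requirement B3 with its un-typed clause as an explicit predicate parameter, and ONE packaging def per
# configuration CFG-07 … CFG-12 over `RHAxisCK2Requirements.lean` (K2-HALF `L = ⌈l⋆/2⌉` · K2-SQRT `L = ⌈√l⋆⌉`)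

abc-iut cell, rung LADDER-ABC:A2.RESCUE.H; seat abc-iut-reqb-typ-1 (GEN 9; KEY `wake/KEY-abc-iut-reqb-typ-1-C-TYPE-K1.md` 884765c520d369cd (3)); desk file
`plan/rescue/R-H/ROUND3/AXIS-CD-DESK.md` 0c01fcd4427e30c7 §AXIS C item (b); sheets CFG-07 cb19957b6da0d088 · CFG-08 f4431961b195a3da · CFG-09 6e59a100246904b5 (rh3-gen-3,
K2-HALF) · CFG-10 aee67afba31ab6ca · CFG-11 6029b68fb927fb16 · CFG-12 83fd4aa848a9c416 (rh3-gen-4, K2-SQRT); companion of `Repair/RHAxisCK2Requirements.lean` (= the two sheet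
seats' offered modules 9dcc4a44e2f9ca6a + af840849ddccf1ff verbatim, re-homed) — split by the 400-line rule (D-0064), same namespace.
§0 `JLCellShadow L μ₀ …` = what the bed actually sees of a `J_L`-theory at a datum: PRINT's hull cell on the labels of `J_L = {1,…,L}` (CFG-10 sheet B2 «Signature over our
currency (its arithmetic shadow, which is all the bed sees)») AND the MEETS word `DD_L ≤ (1 − μ₀)·M_L` at `L` labels (B1; `datum_meets_iff` p522952 at `lstar := L`; CFG-07
sheet B1 «the truncated cell bookkeeping is the EXISTING tree at n = L»); `JLSymmetry L induced` = B3 (a group acting (pre)transitively on the `2L+1` Θ±-labels, Mathlib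
`MulAction.IsPretransitive`, with the sheets' UN-TYPED clause «induced by automorphisms of the (D-)Θ±ell-Hodge theatre, compatible with conjugate synchronisation» as the
explicit predicate PARAMETER `induced` — no landed decl exists for it; KERNEL CONSTRAINT on any instance: the printed groups are excluded, `halfLabelsProductClosed_iff_false` /
`halfPMLabelsAreOrbit_false` / `sqrtLabelsProductClosed_iff_false` / `sqrtPMLabelsAreOrbit_false` in the main file). §6 `K2Half_requirement μ₀` / `K2Sqrt_requirement μ₀` =
the truncated statement at `λ = lamOf μ₀ L` (the `L`-label reading; which λ a k2 × k5 pair carries is a DESK WORD per rh3-gen-4 g10 — the bed words read `μ₀` directly and are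
unaffected) ∧ B3 ∧ the shadow; `CFG07_requirement` … `CFG12_requirement` instantiate `μ₀ = 27/64, ½, ¾`; `truncStatement_print` = print regression BY NAME.
HONEST FRAMING / GUARDS: every `def` here is a HYPOTHETICAL object / requirement in OUR typed cell currency, not a grading of the corpus, not a claim that [IUTchI–III] admit a
truncated evaluation, NEVER a Literature fact (no new `Prop` fact; inputs ⊆ the frozen FACT-LIST f75a60bac22efdb6 + the landed modules imported above); located ≠ adjudicated;
typed ≠ proved; computed ≠ proved; nothing here asserts that abc is proved or refuted, that [IUTchIII] Cor. 3.12 / [IUTchIV] Thm. 1.10 holds or fails, or takes a side on any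
author (D-0045). [claim: Mochizuki2012, status: disputed] for every IUT locution.
[cite: Mochizuki2012, IUTchIII Cor. 3.12 p. 173–174, Rmk. 3.9.3 p. 119–120, Rmk. 3.12.1 (ii) p. 186; IUTchII Rmk. 2.6.3 p. 79–80, Rmk. 3.5.2, 4.5.3; IUTchI Prop. 4.9 (i) p. 115, Def. 6.1]
-/

namespace Summit.ABC.IUTFork.Repair.RH.AxisCK2Requirements

open Summit.ABC.IUTFork Summit.ABC.IUTFork.Thm311 Summit.ABC.IUTFork.Cor312 Literature.IUT.LogThetaLattice

/-! ## §0. The families' common per-datum ARITHMETIC SHADOW in OUR cell currency, and the symmetry requirement B3 -/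

section Shadow

open ReqsideWeightLaws Finset

variable {ι : Type*}

/-- **B1/B2/B5 arithmetic shadow at a datum** (CFG-10 sheet B2 «Signature over our currency (its arithmetic shadow, which is all the bed sees): `∀ w ∈ bad, ∀ j, 1 ≤ j → j ≤ L →
(licensed w j ↔ ReqsideWeightLaws.Cell (fun j => (j:ℤ)^2) 1 (e w) (m w) (δ w) (rin w) (rout w) j)` — i.e. the per-label hull cell is print's, evaluated on J_L only»; B1 «the
truncated requirement `M_L U := reqMass (fun j => (j:ℤ)^2) 1 L U` … MEETS cell `reqThreshold μ₀ (M_L U) K = 0`»; CFG-07 sheet B1 «the truncated cell bookkeeping is the EXISTING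
tree at n = L»): at a datum (places `s`, integer place data `(e, m, δ, r_in, r_out)`, weights `u`, the theory's licence assignment `licensed`) with `L` labels — PRINT's cell on
the labels of `J_L` AND the MEETS word `DD_L ≤ (1 − μ₀)·M_L` (`datum_meets_iff` p522952 at `lstar := L`). (= the k1 file's `AxisCK1Requirements.R1_licenceLaw 4 ∧ R1_meets 4 μ₀`
at label count `L`, by `lawPow_four`; stated over the literal print law to keep this file independent of the k1 file.) HYPOTHESIS in OUR typed cell currency.
[claim: Mochizuki2012, status: disputed] -/
@[claim "Mochizuki2012" "disputed"]
def JLCellShadow (L : ℕ) (μ₀ : ℝ) (s : Finset ι) (e m δ rin rout : ι → ℤ) (u : ι → ℝ) (licensed : ι → ℕ → Prop) : Prop :=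
  (∀ w ∈ s, ∀ j, 1 ≤ j → j ≤ L → (licensed w j ↔ Cell (fun j => (j : ℤ) ^ 2) 1 (e w) (m w) (δ w) (rin w) (rout w) j)) ∧
    datumDeficit (fun j => (j : ℤ) ^ 2) 1 s e m δ rin rout u L ≤
      (1 - μ₀) * reqMass (fun j => (j : ℤ) ^ 2) 1 L (∑ w ∈ s, (m w : ℝ) * u w)

end Shadow

/-- **B3 (NEW OBJECT — a symmetry transitive on `J_L` / `T_L`; replaces [IUTchI] Prop 4.9 / Def 6.1, [IUTchII] Cor 3.5–3.6 / 4.5–4.6 on the truncated set)**, CFG-10 sheet B3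
«`def JLSymmetry (l L : ℕ) : Prop := ∃ (G : Type) (_ : Group G) (_ : MulAction G (Fin (2*L+1))), MulAction.IsPretransitive G (Fin (2*L+1)) ∧ InducedByHodgeTheatreAut G l L`
(`InducedByHodgeTheatreAut` is the UN-TYPED predicate, i.e. the informal part «the action on the cusp labels T_L = {−L,…,L} ⊂ 𝔽_l … is induced by automorphisms of the
(D-)Θ±ell-Hodge theatre and is compatible with conjugate synchronisation [IUTchII] Rmk 3.5.2/4.5.3 …»)»; CFG-07 sheet B3 «a replacement symmetry on 2L+1 ∈ {l⋆+1, l⋆+2} cusp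
labels … that … does NOT come from 𝔽_l^× or 𝔽_l ⋊ {±1} (kernel)». The un-typed clause has NO landed decl and is therefore an explicit hypothesis-predicate PARAMETER `induced`
(flagged: whoever instantiates it supplies the Hodge-theatre meaning). KERNEL CONSTRAINT on any instance: main file §3 / §5 (the printed groups have no orbit of size `2L+1 ∈ [3, l−2]`).
HYPOTHESIS. [claim: Mochizuki2012, status: disputed] -/
@[claim "Mochizuki2012" "disputed"]
def JLSymmetry (L : ℕ) (induced : ∀ (G : Type) [Group G] [MulAction G (Fin (2 * L + 1))], Prop) : Prop :=
  ∃ (G : Type) (_ : Group G) (_ : MulAction G (Fin (2 * L + 1))), MulAction.IsPretransitive G (Fin (2 * L + 1)) ∧ induced G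

/-! ## §6. CFG-07 … CFG-12: one packaging def per configuration (`P` = the typed Cor 3.12 setting carrying `l⋆`; the datum in OUR currency; `induced` = B3's un-typed clause) -/

section CFG

variable {T : ThetaIndex} {S : Situation T} (P : Cor312.Setting S) {ι : Type*}

/-- **K2-HALF packaging** (CFG-07/08/09 (b) summary «NEW OBJECTS … = B2 …, B3 …, B5 (… END SHAPE `TruncStatement P L λ` / `HalfStatement P λ` …)»): at threshold `μ₀`, the
half statement at `λ = λ_L(μ₀)`, `L = ⌈l⋆/2⌉` ∧ a replacement symmetry on `2L+1` labels ∧ the per-datum shadow at `L` labels. HYPOTHESIS. [claim: Mochizuki2012, status: disputed] -/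
@[claim "Mochizuki2012" "disputed"]
def K2Half_requirement (μ₀ : ℚ) (induced : ∀ (G : Type) [Group G] [MulAction G (Fin (2 * halfLen T.lstar + 1))], Prop)
    (s : Finset ι) (e m δ rin rout : ι → ℤ) (u : ι → ℝ) (licensed : ι → ℕ → Prop) : Prop :=
  HalfStatement P ((lamOf μ₀ (halfLen T.lstar) : ℚ) : ℝ) ∧ JLSymmetry (halfLen T.lstar) induced ∧
    JLCellShadow (halfLen T.lstar) (μ₀ : ℝ) s e m δ rin rout u licensed

/-- **K2-SQRT packaging** (CFG-10/11/12 (b) summary «NEW OBJECTS a J_L-theory must construct = B2 …, B3 …, B5 …»): the same at `L = ⌈√l⋆⌉`. HYPOTHESIS.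
[claim: Mochizuki2012, status: disputed] -/
@[claim "Mochizuki2012" "disputed"]
def K2Sqrt_requirement (μ₀ : ℚ) (induced : ∀ (G : Type) [Group G] [MulAction G (Fin (2 * sqrtLen T.lstar + 1))], Prop)
    (s : Finset ι) (e m δ rin rout : ι → ℤ) (u : ι → ℝ) (licensed : ι → ℕ → Prop) : Prop :=
  SqrtStatement P ((lamOf μ₀ (sqrtLen T.lstar) : ℚ) : ℝ) ∧ JLSymmetry (sqrtLen T.lstar) induced ∧
    JLCellShadow (sqrtLen T.lstar) (μ₀ : ℝ) s e m δ rin rout u licensed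

/-- **CFG-07** (`P-k2half-k5mu27/64`; knobs «k1=print k2=trunc:half c=1 cD=1 pk=j+1 rnd=floor mu0=27/64»; sheet cb19957b6da0d088; (a) loci A1.1–A3.3: [IUTchI] Prop 4.9 (i) p.115, Def 6.1,
Prop 6.9 (i); [IUTchII] Rmk 2.6.3, 3.5.2, 4.5.3; [IUTchIII] Def 3.8, Rmk 3.9.3, Cor 3.12, Rmk 3.12.1 (ii)): `K2Half_requirement P (27/64)` (bed face BY NAME p517027; `λ_27 = 28571/192`,
`lamOf_worked`). HYPOTHESIS. [claim: Mochizuki2012, status: disputed] -/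
@[claim "Mochizuki2012" "disputed"]
def CFG07_requirement (induced : ∀ (G : Type) [Group G] [MulAction G (Fin (2 * halfLen T.lstar + 1))], Prop)
    (s : Finset ι) (e m δ rin rout : ι → ℤ) (u : ι → ℝ) (licensed : ι → ℕ → Prop) : Prop :=
  K2Half_requirement P (27 / 64) induced s e m δ rin rout u licensed

/-- **CFG-08** (`P-k2half-k5mu1/2`; sheet f4431961b195a3da): `K2Half_requirement P (1/2)` (faces p515894 + p516971; `λ_27 = 773/6`). HYPOTHESIS. [claim: Mochizuki2012, status: disputed] -/
@[claim "Mochizuki2012" "disputed"]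
def CFG08_requirement (induced : ∀ (G : Type) [Group G] [MulAction G (Fin (2 * halfLen T.lstar + 1))], Prop)
    (s : Finset ι) (e m δ rin rout : ι → ℤ) (u : ι → ℝ) (licensed : ι → ℕ → Prop) : Prop :=
  K2Half_requirement P (1 / 2) induced s e m δ rin rout u licensed

/-- **CFG-09** (`P-k2half-k5mu3/4`; sheet 6e59a100246904b5; truncation LOAD-BEARING on FREY133 per the sheet's rider): `K2Half_requirement P (3/4)` (faces p515847 + p516593;
`λ_27 = 779/12`). HYPOTHESIS. [claim: Mochizuki2012, status: disputed] -/
@[claim "Mochizuki2012" "disputed"]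
def CFG09_requirement (induced : ∀ (G : Type) [Group G] [MulAction G (Fin (2 * halfLen T.lstar + 1))], Prop)
    (s : Finset ι) (e m δ rin rout : ι → ℤ) (u : ι → ℝ) (licensed : ι → ℕ → Prop) : Prop :=
  K2Half_requirement P (3 / 4) induced s e m δ rin rout u licensed

/-- **CFG-10** (`P-k2sqrt-k5mu27/64`; knobs «k1=print k2=trunc:sqrt … mu0=27/64»; sheet aee67afba31ab6ca; (a) loci as CFG-07 + [IUTchI] Prop 6.9 (i) p.169, [IUTchIV] p.39): `K2Sqrt_requirement P
(27/64)` (bed face BY NAME p516583; `λ_8 = 1941/128`, `lamOf_sqrt_worked`). HYPOTHESIS. [claim: Mochizuki2012, status: disputed] -/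
@[claim "Mochizuki2012" "disputed"]
def CFG10_requirement (induced : ∀ (G : Type) [Group G] [MulAction G (Fin (2 * sqrtLen T.lstar + 1))], Prop)
    (s : Finset ι) (e m δ rin rout : ι → ℤ) (u : ι → ℝ) (licensed : ι → ℕ → Prop) : Prop :=
  K2Sqrt_requirement P (27 / 64) induced s e m δ rin rout u licensed

/-- **CFG-11** (`P-k2sqrt-k5mu1/2`; sheet 6029b68fb927fb16): `K2Sqrt_requirement P (1/2)` (`λ_8 = 53/4`). HYPOTHESIS. [claim: Mochizuki2012, status: disputed] -/
@[claim "Mochizuki2012" "disputed"]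
def CFG11_requirement (induced : ∀ (G : Type) [Group G] [MulAction G (Fin (2 * sqrtLen T.lstar + 1))], Prop)
    (s : Finset ι) (e m δ rin rout : ι → ℤ) (u : ι → ℝ) (licensed : ι → ℕ → Prop) : Prop :=
  K2Sqrt_requirement P (1 / 2) induced s e m δ rin rout u licensed

/-- **CFG-12** (`P-k2sqrt-k5mu3/4`; sheet 83fd4aa848a9c416): `K2Sqrt_requirement P (3/4)` (`λ_8 = 57/8`). HYPOTHESIS. [claim: Mochizuki2012, status: disputed] -/
@[claim "Mochizuki2012" "disputed"]
def CFG12_requirement (induced : ∀ (G : Type) [Group G] [MulAction G (Fin (2 * sqrtLen T.lstar + 1))], Prop)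
    (s : Finset ι) (e m δ rin rout : ι → ℤ) (u : ι → ℝ) (licensed : ι → ℕ → Prop) : Prop :=
  K2Sqrt_requirement P (3 / 4) induced s e m δ rin rout u licensed

/-- PRINT REGRESSION of the packaging: with NO truncation (`L = l⋆`) and `λ = 1` the statement conjunct IS [IUTchIII] Cor 3.12 as typed (`truncStatement_lstar_one_iff`). [folklore] -/
theorem truncStatement_print (h : P.Statement) : TruncStatement P T.lstar 1 :=
  (truncStatement_lstar_one_iff P).2 h

end CFG

end Summit.ABC.IUTFork.Repair.RH.AxisCK2Requirements
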